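import Summits.Ventures.PercRepro.RankLevelSetHCore

/-!
# PercRepro — C-025 Theorem H, Steps 1–2: rank-3 sets from lines and the `U`-side injection (p2, gen 5; split gen 6)

Continuation of `RankLevelSetHCore.lean` (the lines API).  Step 1 (`step_one`): `3·#Y ≥ Σ_L |E ∖ L|·(3·a₃(L) + C(|L|,2))`
by the injections `(L, B, x) ↦ B ∪ {x}`; Step 2 (`step_two`): `#U(4,2) ≤ Σ_L #U_L` by `A ↦ (cl(E ∖ A), E ∖ A)`.
The per-line Step 3 and the assembly are `RankLevelSetHClose.lean`.
-/

namespace PercRepro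

namespace ThmH

open Finset

variable {α : Type*} [DecidableEq α]

section StepOne

variable {M : Matroid α} [M.Finite]

open scoped Classical in
/-- The rank-3 sets with at least four points. -/
noncomputable def Y4 (M : Matroid α) [M.Finite] : Finset (Finset α) :=
  (gr M).powerset.filter (fun S => M.eRk (S : Set α) = 3 ∧ 4 ≤ S.card)

open scoped Classical in
/-- The rank-3 sets with exactly three points (independent triples). -/
noncomputable def Y3 (M : Matroid α) [M.Finite] : Finset (Finset α) :=
  (gr M).powerset.filter (fun S => M.eRk (S : Set α) = 3 ∧ S.card = 3)

open scoped Classical in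
/-- All rank-3 sets. -/
noncomputable def Yall (M : Matroid α) [M.Finite] : Finset (Finset α) :=
  (gr M).powerset.filter (fun S => M.eRk (S : Set α) = 3)

open scoped Classical in
/-- Triples `(L, B, x)`: a line `L`, a subset `B ⊆ L` with at least three points, a point `x ∉ L`. -/
noncomputable def T1 (M : Matroid α) [M.Finite] : Finset (Σ _ : Finset α, Finset α × α) :=
  (lines M).sigma (fun L => (L.powerset.filter (fun B => 3 ≤ B.card)) ×ˢ (gr M \ L))

/-- Triples `(L, B, x)`: a line `L`, a pair `B ⊆ L`, a point `x ∉ L`. -/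
noncomputable def T2 (M : Matroid α) [M.Finite] : Finset (Σ _ : Finset α, Finset α × α) :=
  (lines M).sigma (fun L => (L.powersetCard 2) ×ˢ (gr M \ L))

/-- The set `B ∪ {x}` attached to a triple. -/
def fS (p : Σ _ : Finset α, Finset α × α) : Finset α := insert p.2.2 p.2.1

open scoped Classical in
/-- `#T1 = Σ_L a₃(L)·|E ∖ L|`. -/
theorem card_T1 (M : Matroid α) [M.Finite] :
    (T1 M).card = ∑ L ∈ lines M, (L.powerset.filter (fun B => 3 ≤ B.card)).card * (gr M \ L).card := by
  rw [T1, Finset.card_sigma]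
  simp only [Finset.card_product]

/-- `#T2 = Σ_L C(|L|,2)·|E ∖ L|`. -/
theorem card_T2 (M : Matroid α) [M.Finite] :
    (T2 M).card = ∑ L ∈ lines M, L.card.choose 2 * (gr M \ L).card := by
  rw [T2, Finset.card_sigma]
  simp only [Finset.card_product, Finset.card_powersetCard]

/-- The set of a triple of `T1` is a rank-3 set with at least four points. -/
theorem fS_mem_Y4 (hs : Simple M) {p : Σ _ : Finset α, Finset α × α} (hp : p ∈ T1 M) : fS p ∈ Y4 M := by
  obtain ⟨L, B, x⟩ := p
  simp only [T1, Finset.mem_sigma, Finset.mem_product, Finset.mem_filter, Finset.mem_powerset,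
    Finset.mem_sdiff] at hp
  obtain ⟨hL, ⟨hB, hB3⟩, hx, hxL⟩ := hp
  have hxB : x ∉ B := fun h => hxL (hB h)
  simp only [Y4, fS, Finset.mem_filter, Finset.mem_powerset]
  refine ⟨?_, eRk_insert_eq_three hs hL hB (by omega) hx hxL, ?_⟩
  · exact Finset.insert_subset hx (hB.trans (mem_lines.1 hL).1)
  · rw [Finset.card_insert_of_notMem hxB]; omega

/-- The set of a triple of `T2` is an independent triple. -/
theorem fS_mem_Y3 (hs : Simple M) {p : Σ _ : Finset α, Finset α × α} (hp : p ∈ T2 M) : fS p ∈ Y3 M := by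
  obtain ⟨L, B, x⟩ := p
  simp only [T2, Finset.mem_sigma, Finset.mem_product, Finset.mem_powersetCard, Finset.mem_sdiff] at hp
  obtain ⟨hL, ⟨hB, hB2⟩, hx, hxL⟩ := hp
  have hxB : x ∉ B := fun h => hxL (hB h)
  simp only [Y3, fS, Finset.mem_filter, Finset.mem_powerset]
  refine ⟨?_, eRk_insert_eq_three hs hL hB (by omega) hx hxL, ?_⟩
  · exact Finset.insert_subset hx (hB.trans (mem_lines.1 hL).1)
  · rw [Finset.card_insert_of_notMem hxB]; omega

/-- Recovering `B` from `insert x B` when `x ∉ B`. -/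
theorem erase_insert_eq {B : Finset α} {x : α} (hxB : x ∉ B) : (insert x B).erase x = B :=
  Finset.erase_insert hxB

/-- A triple of `T1` is determined by its set (two lines through two common points coincide). -/
theorem fS_injOn_T1 (hs : Simple M) : Set.InjOn fS (T1 M : Set (Σ _ : Finset α, Finset α × α)) := by
  rintro ⟨L, B, x⟩ hp ⟨L', B', x'⟩ hp' heq
  simp only [Finset.mem_coe, T1, Finset.mem_sigma, Finset.mem_product, Finset.mem_filter,
    Finset.mem_powerset, Finset.mem_sdiff] at hp hp'
  obtain ⟨hL, ⟨hB, hB3⟩, hx, hxL⟩ := hp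
  obtain ⟨hL', ⟨hB', hB3'⟩, hx', hxL'⟩ := hp'
  have hxB : x ∉ B := fun h => hxL (hB h)
  have hxB' : x' ∉ B' := fun h => hxL' (hB' h)
  simp only [fS] at heq
  -- B ∩ B' has at least two points
  have hBsub : B ⊆ insert x' B' := by rw [← heq]; exact Finset.subset_insert _ _
  have hB'sub : B' ⊆ insert x B := by rw [heq]; exact Finset.subset_insert _ _
  have hcardS : (insert x B).card = B.card + 1 := Finset.card_insert_of_notMem hxB
  have hcardS' : (insert x' B').card = B'.card + 1 := Finset.card_insert_of_notMem hxB'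
  have hunion : B ∪ B' ⊆ insert x B := Finset.union_subset (Finset.subset_insert _ _) hB'sub
  have hcardU : (B ∪ B').card ≤ B.card + 1 := hcardS ▸ Finset.card_le_card hunion
  have hinter : 2 ≤ (B ∩ B').card := by
    have := Finset.card_union_add_card_inter B B'
    have hB'c : B'.card = B.card := by rw [heq] at hcardS; omega
    omega
  obtain ⟨a, ha, b, hb, hab⟩ := Finset.one_lt_card.1 hinter
  rw [Finset.mem_inter] at ha hb
  have hLL : L = L' := lines_eq_of_two_mem hs hL hL' (hB ha.1) (hB hb.1) (hB' ha.2) (hB' hb.2) hab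
  subst hLL
  -- B = B' (the points of the set on the line), then x = x'
  have hBB : B = B' := by
    ext y
    constructor
    · intro hy
      have hy' : y ∈ insert x' B' := hBsub hy
      rw [Finset.mem_insert] at hy'
      rcases hy' with rfl | hy'
      · exact absurd (hB hy) hxL'
      · exact hy'
    · intro hy
      have hy' : y ∈ insert x B := hB'sub hy
      rw [Finset.mem_insert] at hy'
      rcases hy' with rfl | hy'
      · exact absurd (hB' hy) hxL
      · exact hy'
  subst hBB
  have hxx : x = x' := by
    have : x ∈ insert x' B := by rw [← heq]; exact Finset.mem_insert_self _ _
    rw [Finset.mem_insert] at this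
    rcases this with h | h
    · exact h
    · exact absurd h hxB
  subst hxx
  rfl

/-- `#T1 ≤ #Y4`. -/
theorem card_T1_le (hs : Simple M) : (T1 M).card ≤ (Y4 M).card :=
  Finset.card_le_card_of_injOn fS (fun _ hp => fS_mem_Y4 hs hp) (fS_injOn_T1 hs)

/-- Every independent triple is the set of at most three triples of `T2` (the choice of `x`). -/
theorem card_fiber_T2_le (hs : Simple M) {S : Finset α} (hS : S ∈ Y3 M) :
    ((T2 M).filter (fun p => fS p = S)).card ≤ 3 := by
  have hS3 : S.card = 3 := (Finset.mem_filter.1 hS).2.2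
  rw [← hS3]
  refine Finset.card_le_card_of_injOn (fun p => p.2.2) ?_ ?_
  · rintro ⟨L, B, x⟩ hp
    simp only [Finset.mem_coe, Finset.mem_filter, fS] at hp
    rw [Finset.mem_coe, ← hp.2]
    exact Finset.mem_insert_self _ _
  · rintro ⟨L, B, x⟩ hp ⟨L', B', x'⟩ hp' hxx
    simp only at hxx
    subst hxx
    simp only [Finset.mem_coe, Finset.mem_filter, T2, Finset.mem_sigma, Finset.mem_product,
      Finset.mem_powersetCard, Finset.mem_sdiff, fS] at hp hp'
    obtain ⟨⟨hL, ⟨hB, hB2⟩, hx, hxL⟩, heq⟩ := hp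
    obtain ⟨⟨hL', ⟨hB', hB2'⟩, -, hxL'⟩, heq'⟩ := hp'
    have hxB : x ∉ B := fun h => hxL (hB h)
    have hxB' : x ∉ B' := fun h => hxL' (hB' h)
    have hBB : B = B' := by
      rw [← erase_insert_eq hxB, ← erase_insert_eq hxB', heq, heq']
    subst hBB
    obtain ⟨a, ha, b, hb, hab⟩ := Finset.one_lt_card.1 (show 1 < B.card by omega)
    have hLL : L = L' := lines_eq_of_two_mem hs hL hL' (hB ha) (hB hb) (hB' ha) (hB' hb) hab
    subst hLL
    rfl

/-- `#T2 ≤ 3·#Y3`. -/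
theorem card_T2_le (hs : Simple M) : (T2 M).card ≤ 3 * (Y3 M).card :=
  Finset.card_le_mul_card_image_of_maps_to (fun _ hp => fS_mem_Y3 hs hp) 3
    (fun _ hS => card_fiber_T2_le hs hS)

/-- `#Y4 + #Y3 ≤ #Yall` (disjoint subfamilies of the rank-3 sets). -/
theorem card_Y4_add_card_Y3_le (M : Matroid α) [M.Finite] : (Y4 M).card + (Y3 M).card ≤ (Yall M).card := by
  classical
  rw [← Finset.card_union_of_disjoint]
  · apply Finset.card_le_card
    intro S hS
    simp only [Finset.mem_union, Y4, Y3, Yall, Finset.mem_filter] at hS ⊢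
    rcases hS with ⟨h1, h2, -⟩ | ⟨h1, h2, -⟩ <;> exact ⟨h1, h2⟩
  · rw [Finset.disjoint_left]
    intro S h4 h3
    simp only [Y4, Y3, Finset.mem_filter] at h4 h3
    omega

/-- **Step 1**: `3·#Y ≥ Σ_L |E ∖ L|·(3·a₃(L) + C(|L|, 2))`. -/
theorem step_one (hs : Simple M) :
    ∑ L ∈ lines M, (3 * (L.powerset.filter (fun B => 3 ≤ B.card)).card + L.card.choose 2) * (gr M \ L).card ≤
      3 * (Yall M).card := by
  classical
  have h1 := card_T1_le hs
  have h2 := card_T2_le hs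
  have h3 := card_Y4_add_card_Y3_le M
  rw [card_T1] at h1
  rw [card_T2] at h2
  have : ∑ L ∈ lines M, (3 * (L.powerset.filter (fun B => 3 ≤ B.card)).card + L.card.choose 2) * (gr M \ L).card
      = 3 * ∑ L ∈ lines M, (L.powerset.filter (fun B => 3 ≤ B.card)).card * (gr M \ L).card +
        ∑ L ∈ lines M, L.card.choose 2 * (gr M \ L).card := by
    rw [Finset.mul_sum, ← Finset.sum_add_distrib]
    apply Finset.sum_congr rfl
    intro L _
    ring
  rw [this]
  omega

end StepOne

section StepTwo

variable {M : Matroid α} [M.Finite]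

open scoped Classical in
/-- `U(4,2)` on finsets: `A ⊆ E` with `ρ(A) = 4` and `ρ(E ∖ A) = 2`. -/
noncomputable def Uf (M : Matroid α) [M.Finite] : Finset (Finset α) :=
  (gr M).powerset.filter (fun A => M.eRk (A : Set α) = 4 ∧ M.eRk ((gr M \ A : Finset α) : Set α) = 2)

open scoped Classical in
/-- `U_L`: the subsets `B ⊆ L` with at least two points and `ρ(E ∖ B) = 4`. -/
noncomputable def UL (M : Matroid α) [M.Finite] (L : Finset α) : Finset (Finset α) :=
  L.powerset.filter (fun B => 2 ≤ B.card ∧ M.eRk ((gr M \ B : Finset α) : Set α) = 4)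

/-- The disjoint union of the `U_L` over the lines. -/
noncomputable def T3 (M : Matroid α) [M.Finite] : Finset (Σ _ : Finset α, Finset α) :=
  (lines M).sigma (fun L => UL M L)

/-- `A ↦ (cl(E ∖ A), E ∖ A)`. -/
noncomputable def gU (M : Matroid α) [M.Finite] (A : Finset α) : Σ _ : Finset α, Finset α :=
  ⟨clF M (gr M \ A), gr M \ A⟩

/-- `#T3 = Σ_L #U_L`. -/
theorem card_T3 (M : Matroid α) [M.Finite] : (T3 M).card = ∑ L ∈ lines M, (UL M L).card := by
  rw [T3, Finset.card_sigma]

/-- `gU` sends `U(4,2)` into `T3`. -/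
theorem gU_mem_T3 {A : Finset α} (hA : A ∈ Uf M) : gU M A ∈ T3 M := by
  simp only [Uf, Finset.mem_filter, Finset.mem_powerset] at hA
  obtain ⟨hAE, hA4, hA2⟩ := hA
  have hsub : gr M \ A ⊆ gr M := Finset.sdiff_subset
  obtain ⟨hline, hBcl⟩ := clF_mem_lines hsub hA2
  simp only [gU, T3, Finset.mem_sigma, UL, Finset.mem_filter, Finset.mem_powerset]
  refine ⟨hline, hBcl, ?_, ?_⟩
  · have h := M.eRk_le_encard ((gr M \ A : Finset α) : Set α)
    rw [hA2, Set.encard_coe_eq_coe_finsetCard] at h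
    exact_mod_cast h
  · rw [Finset.sdiff_sdiff_eq_self hAE]
    exact hA4

/-- `gU` is injective on `U(4,2)`. -/
theorem gU_injOn : Set.InjOn (gU M) (Uf M : Set (Finset α)) := by
  intro A hA A' hA' h
  simp only [Finset.mem_coe, Uf, Finset.mem_filter, Finset.mem_powerset] at hA hA'
  have h2 : gr M \ A = gr M \ A' := by
    have := congrArg Sigma.snd h
    simpa [gU] using this
  rw [← Finset.sdiff_sdiff_eq_self hA.1, ← Finset.sdiff_sdiff_eq_self hA'.1, h2]

/-- **Step 2**: `#U(4,2) ≤ Σ_L #U_L`. -/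
theorem step_two (M : Matroid α) [M.Finite] : (Uf M).card ≤ ∑ L ∈ lines M, (UL M L).card := by
  rw [← card_T3]
  exact Finset.card_le_card_of_injOn (gU M) (fun _ hA => gU_mem_T3 hA) gU_injOn

end StepTwo

end ThmH

end PercRepro
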